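import Summits.SmoothPoincare4.SmoothPoincare4.Theorems.SullivanDualWitnessChargeHelperMemberFarCovers
import Summits.SmoothPoincare4.SmoothPoincare4.Theorems.SullivanDualWitnessChargeHelperMemberGraphMain
import Summits.SmoothPoincare4.SmoothPoincare4.Theorems.SullivanDualWitnessChargeHelperEndHolomorphic
import Summits.SmoothPoincare4.SmoothPoincare4.Theorems.SullivanDualWitnessChargeHelperHurwitz
import Summits.SmoothPoincare4.SmoothPoincare4.Theorems.SullivanDualWitnessChargeHelperIsPreconnectedNormGt
import Mathlib.Analysis.Complex.Basic
import Mathlib.Analysis.Complex.RealDeriv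
import Mathlib.Analysis.Complex.LocallyUniformLimit
import Mathlib.Analysis.Calculus.MeanValue

/-!
# Helper `helper_limitHoloFar` of line `Sketch` for crux `WitnessCharge`
(item stmt-SmoothPoincare4-7824; route `SullivanDual`, crux
`Summit.SmoothPoincare4.SmoothPoincare4.Theses.SullivanDual.WitnessCharge`; line `Sketch`,
registered stub `helper_limitHoloFar` of the lead's cycle-2 helper skeleton, wave 3 — (N)-branch,
univalence and immersion of the far end of the limit)

**The far end of the limit of pencil members is univalent and immersed.** Let `J` be STANDARD on
the punctured `ε'`-chart-ball `B_{ε'}` at `p` (closed `ε'`-ball inside the chart target), let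
`u n : ℂ → Σ∖p` be pencil members, let `G : ℂ → Σ∖p` be `C^∞` and `J`-holomorphic, and for some
`R > ε'⁻¹` suppose: `G` maps the far region `V = {ξ | 2R < ‖ξ‖}` into `B_{ε'}`, the flat
coordinates `Ycoord p (u (φ k) ξ)` converge to `Ycoord p (G ξ)` locally uniformly on `V`, and the
first flat coordinate `φ⋆ = z ∘ G` of the limit satisfies the decay bound
`‖φ⋆ ξ − ξ‖ ≤ 48 R² / ‖ξ‖` for `‖ξ‖ ≥ 4R`. Then `G` is injective on `V` and `dG(ξ)` is injective
for every `ξ ∈ V`.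

Proof (one complex variable in the flat end).
* `V` is open and preconnected (`helper_isPreconnected_normGt`).
* Each `φ_k = z ∘ u (φ k)` is holomorphic on `V` (`helper_endHolomorphic`, (E0)), injective on `V`
  with zero-free derivative there (`helper_memberFarCovers`: `V ⊆ G_R(k)`; `helper_memberGraph`:
  `φ_k` is a bijection `G_R(k) → {R < ‖z‖}` with `φ_k' ≠ 0`); `φ⋆` is holomorphic on `V`
  (`helper_endHolomorphic` for `G`), and `φ_k → φ⋆` locally uniformly on `V` (first components).
* Hurwitz (univalence, `helper_hurwitzInjective`): `φ⋆` is constant or injective on `V`; the decay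
  bound at `ξ = 4R` and `ξ = 100R` rules out constancy (`limitHoloFar_not_const`). So `φ⋆`, hence
  `G`, is injective on `V`.
* Hurwitz (zeros, `helper_hurwitz`) for `φ_k' → φ⋆'` (`TendstoLocallyUniformlyOn.deriv`): `φ⋆'`
  is identically zero or zero-free on `V`; identically zero would make `φ⋆` constant on the
  preconnected open `V` (`IsOpen.exists_is_const_of_deriv_eq_zero`), excluded as before.
* Immersion: `d(Ycoord ∘ G)(ξ) ζ = complexify (Dψ(G ξ) (dG(ξ) ζ))` (`helper_endHolomorphic`) has
  first component `φ⋆'(ξ) ζ` (`fst_fderiv_eq_deriv_mul`); so `dG(ξ) ζ = dG(ξ) ζ'` forces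
  `φ⋆'(ξ) ζ = φ⋆'(ξ) ζ'`, i.e. `ζ = ζ'` as `φ⋆'(ξ) ≠ 0`.

Everything here is proved; no facts and no `Prop`-valued definitions are introduced.
-/

noncomputable section

-- the prescribed namespace `Summit.<P>.<Sub>.…` duplicates `SmoothPoincare4` (P = Sub)
set_option linter.dupNamespace false

open scoped Manifold ContDiff Topology
open Set Filter Literature.Geometry.Kaehler Literature.Geometry.Symplectic
  Literature.Topology.FourManifolds

namespace Summit.SmoothPoincare4.SmoothPoincare4.Theorems.WitnessCharge.PencilIncompleteness

/-! ### Two flat one-variable lemmas -/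

/-- **The decay bound excludes constancy on the far region.** If `‖f ξ − ξ‖ ≤ 48 R² / ‖ξ‖` for
`‖ξ‖ ≥ 4R` (`R > 0`), then `f` is not constant on `{2R < ‖ξ‖}`: at `ξ₁ = 4R` and `ξ₂ = 100R`
the bound gives `‖f ξ₁ − ξ₁‖ ≤ 12R` and `‖f ξ₂ − ξ₂‖ ≤ 12R/25`, while `‖ξ₂ − ξ₁‖ = 96R`. -/
theorem limitHoloFar_not_const {f : ℂ → ℂ} {R : ℝ} (hR : 0 < R)
    (hdecay : ∀ ξ : ℂ, 4 * R ≤ ‖ξ‖ → ‖f ξ - ξ‖ ≤ 48 * R ^ 2 / ‖ξ‖) {c : ℂ}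
    (hc : ∀ z ∈ {ξ : ℂ | 2 * R < ‖ξ‖}, f z = c) : False := by
  have hn1 : ‖((4 * R : ℝ) : ℂ)‖ = 4 * R := by
    rw [Complex.norm_real, Real.norm_of_nonneg (by positivity)]
  have hn2 : ‖((100 * R : ℝ) : ℂ)‖ = 100 * R := by
    rw [Complex.norm_real, Real.norm_of_nonneg (by positivity)]
  have h1 : ‖f ((4 * R : ℝ) : ℂ) - ((4 * R : ℝ) : ℂ)‖ ≤ 12 * R := by
    have h := hdecay ((4 * R : ℝ) : ℂ) (by rw [hn1])
    rw [hn1] at h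
    calc ‖f ((4 * R : ℝ) : ℂ) - ((4 * R : ℝ) : ℂ)‖ ≤ 48 * R ^ 2 / (4 * R) := h
      _ = 12 * R := by rw [div_eq_iff (by positivity)]; ring
  have h2 : ‖f ((100 * R : ℝ) : ℂ) - ((100 * R : ℝ) : ℂ)‖ ≤ 12 * R / 25 := by
    have h := hdecay ((100 * R : ℝ) : ℂ) (by rw [hn2]; linarith)
    rw [hn2] at h
    calc ‖f ((100 * R : ℝ) : ℂ) - ((100 * R : ℝ) : ℂ)‖ ≤ 48 * R ^ 2 / (100 * R) := h
      _ = 12 * R / 25 := by rw [div_eq_div_iff (by positivity) (by positivity)]; ring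
  have hc1 : f ((4 * R : ℝ) : ℂ) = c :=
    hc _ (show 2 * R < ‖((4 * R : ℝ) : ℂ)‖ by rw [hn1]; linarith)
  have hc2 : f ((100 * R : ℝ) : ℂ) = c :=
    hc _ (show 2 * R < ‖((100 * R : ℝ) : ℂ)‖ by rw [hn2]; linarith)
  have hn3 : ‖((100 * R : ℝ) : ℂ) - ((4 * R : ℝ) : ℂ)‖ = 96 * R := by
    have h : ((100 * R : ℝ) : ℂ) - ((4 * R : ℝ) : ℂ) = ((96 * R : ℝ) : ℂ) := by
      push_cast; ring
    rw [h, Complex.norm_real, Real.norm_of_nonneg (by positivity)]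
  have htri : ‖((100 * R : ℝ) : ℂ) - ((4 * R : ℝ) : ℂ)‖ ≤
      ‖f ((4 * R : ℝ) : ℂ) - ((4 * R : ℝ) : ℂ)‖ + ‖f ((100 * R : ℝ) : ℂ) - ((100 * R : ℝ) : ℂ)‖ := by
    have h : ((100 * R : ℝ) : ℂ) - ((4 * R : ℝ) : ℂ) =
        (f ((4 * R : ℝ) : ℂ) - ((4 * R : ℝ) : ℂ)) - (f ((100 * R : ℝ) : ℂ) - ((100 * R : ℝ) : ℂ)) := by
      rw [hc1, hc2]; ring
    rw [h]
    exact norm_sub_le _ _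
  rw [hn3] at htri
  linarith

/-- **First component of the real derivative of a map `ℂ → ℂ × ℂ` with holomorphic first
component.** If `Y` is real differentiable at `ξ` and `ξ ↦ (Y ξ).1` is complex differentiable at
`ξ`, then `(dY(ξ) ζ).1 = (Y₁)'(ξ) · ζ` (uniqueness of the Fréchet derivative: `HasFDerivAt.fst`
versus `HasDerivAt.complexToReal_fderiv`). -/
theorem fst_fderiv_eq_deriv_mul {Y : ℂ → ℂ × ℂ} {ξ : ℂ} (hY : DifferentiableAt ℝ Y ξ)
    (hf : DifferentiableAt ℂ (fun ξ => (Y ξ).1) ξ) (ζ : ℂ) :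
    (fderiv ℝ Y ξ ζ).1 = deriv (fun ξ => (Y ξ).1) ξ * ζ := by
  have h1 : HasFDerivAt (fun ξ => (Y ξ).1)
      ((ContinuousLinearMap.fst ℝ ℂ ℂ).comp (fderiv ℝ Y ξ)) ξ :=
    hY.hasFDerivAt.fst
  have h2 : HasFDerivAt (fun ξ => (Y ξ).1)
      (deriv (fun ξ => (Y ξ).1) ξ • (1 : ℂ →L[ℝ] ℂ)) ξ :=
    hf.hasDerivAt.complexToReal_fderiv
  have h3 := DFunLike.congr_fun (h1.unique h2) ζ
  rw [ContinuousLinearMap.comp_apply, ContinuousLinearMap.coe_fst', smul_apply, one_apply_eq_self,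
    smul_eq_mul] at h3
  exact h3

/-! ### The helper -/

/-- **Univalence and immersion of the far end of the limit (helper `helper_limitHoloFar`,
(N)-branch of line `Sketch`).** For `J` standard on the punctured `ε'`-chart-ball at `p` (closed
`ε'`-ball inside the chart target), pencil members `u n`, a `C^∞` `J`-holomorphic `G : ℂ → Σ∖p`
and `R > ε'⁻¹` such that `G` maps `V = {2R < ‖ξ‖}` into the ball, the flat coordinates of
`u (φ k)` converge to those of `G` locally uniformly on `V`, and `‖z(G ξ) − ξ‖ ≤ 48R²/‖ξ‖` for
`‖ξ‖ ≥ 4R`: `G` is injective on `V` and `dG(ξ)` is injective for `ξ ∈ V`. Hurwitz's theorems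
(univalence for `z ∘ u (φ k) → z ∘ G`, zeros for the derivatives) in the flat end, where `J` is
multiplication by `i` (`helper_endHolomorphic`). -/
theorem helper_limitHoloFar :
    ∀ (S : HomotopySphere 4) (p : S.carrier)
      (J : ∀ x : punctured p, TangentSpace (𝓡 4) x →L[ℝ] TangentSpace (𝓡 4) x) (ε' : ℝ),
      0 < ε' →
      Metric.closedBall (extChartAt (𝓡 4) p p) ε' ⊆ (extChartAt (𝓡 4) p).target →
      (∀ x : punctured p, InPuncturedChartBall p ε' x →
        ∀ (v : TangentSpace (𝓡 4) x) (b : EuclideanSpace ℝ (Fin 4)),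
          inner ℝ (fderiv ℝ inversion (extChartAt (𝓡 4) p x.1 - extChartAt (𝓡 4) p p)
            (mfderiv (𝓡 4) 𝓘(ℝ, EuclideanSpace ℝ (Fin 4))
              (fun z : punctured p => extChartAt (𝓡 4) p z.1) x (J x v))) b
          = stdSymplecticForm (fderiv ℝ inversion (extChartAt (𝓡 4) p x.1 - extChartAt (𝓡 4) p p)
            (mfderiv (𝓡 4) 𝓘(ℝ, EuclideanSpace ℝ (Fin 4))
              (fun z : punctured p => extChartAt (𝓡 4) p z.1) x v)) b) →
      ∀ (u : ℕ → ℂ → punctured p) (b : ℕ → ℂ) (G : ℂ → punctured p) (φ : ℕ → ℕ),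
        (∀ n, IsPencilMember J (u n) (b n)) →
        ContMDiff 𝓘(ℝ, ℂ) (𝓡 4) ∞ G → IsJHolomorphic (𝓡 4) J G →
        ∀ R : ℝ, ε'⁻¹ < R →
        (∀ ξ : ℂ, 2 * R < ‖ξ‖ → InPuncturedChartBall p ε' (G ξ)) →
        TendstoLocallyUniformlyOn (fun k ξ => Ycoord p (u (φ k) ξ)) (fun ξ => Ycoord p (G ξ))
          atTop {ξ : ℂ | 2 * R < ‖ξ‖} →
        (∀ ξ : ℂ, 4 * R ≤ ‖ξ‖ → ‖(Ycoord p (G ξ)).1 - ξ‖ ≤ 48 * R ^ 2 / ‖ξ‖) →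
        Set.InjOn G {ξ : ℂ | 2 * R < ‖ξ‖} ∧
          ∀ ξ : ℂ, 2 * R < ‖ξ‖ → Function.Injective (mfderiv 𝓘(ℝ, ℂ) (𝓡 4) G ξ) := by
  intro S p J ε' hε' hball hJstd u b G φ hu hGs hGJ R hR hGfar hconvY hdecay
  -- the far region `V = {2R < ‖ξ‖}`: open and preconnected; `R > 0`
  have hRpos : 0 < R := (inv_pos.2 hε').trans hR
  have hVopen : IsOpen {ξ : ℂ | 2 * R < ‖ξ‖} := isOpen_lt continuous_const continuous_norm
  have hVpre : IsPreconnected {ξ : ℂ | 2 * R < ‖ξ‖} := helper_isPreconnected_normGt (2 * R)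
  -- (1) the members `φ_k = z ∘ u (φ k)`: holomorphic and injective on `V`, with `φ_k' ≠ 0` there
  have hcov : ∀ (k : ℕ) (ξ : ℂ), 2 * R < ‖ξ‖ →
      InPuncturedChartBall p ε' (u (φ k) ξ) ∧ R < ‖(Ycoord p (u (φ k) ξ)).1‖ := fun k =>
    helper_memberFarCovers S p J ε' (u (φ k)) (b (φ k)) hε' hball hJstd (hu (φ k)) R hR
  have hFdiff : ∀ k : ℕ, DifferentiableOn ℂ (fun ξ : ℂ => (Ycoord p (u (φ k) ξ)).1)
      {ξ : ℂ | 2 * R < ‖ξ‖} := by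
    intro k
    obtain ⟨hcurve, -, -, -, -, -⟩ := hu (φ k)
    obtain ⟨-, hdiff, -, -⟩ := helper_endHolomorphic S p J ε' hε' hball hJstd (u (φ k))
      hcurve.contMDiff hcurve.isJHolomorphic
    exact (hdiff.mono (s := {ξ : ℂ | 2 * R < ‖ξ‖}) fun ξ hξ => (hcov k ξ hξ).1).fst
  have hFinj : ∀ k : ℕ, InjOn (fun ξ : ℂ => (Ycoord p (u (φ k) ξ)).1) {ξ : ℂ | 2 * R < ‖ξ‖} :=
    fun k => (helper_memberGraph S p J ε' (u (φ k)) (b (φ k)) hε' hball hJstd (hu (φ k)) R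
      hR).1.injOn.mono fun ξ hξ => hcov k ξ hξ
  have hFder : ∀ k : ℕ, ∀ ξ ∈ {ξ : ℂ | 2 * R < ‖ξ‖},
      deriv (fun ξ : ℂ => (Ycoord p (u (φ k) ξ)).1) ξ ≠ 0 :=
    fun k ξ hξ => (helper_memberGraph S p J ε' (u (φ k)) (b (φ k)) hε' hball hJstd (hu (φ k)) R
      hR).2 ξ (hcov k ξ hξ).1 (hcov k ξ hξ).2
  -- (1b) the limit `φ⋆ = z ∘ G`: holomorphic on `V`; the derivative formula for `Ycoord ∘ G`
  obtain ⟨-, hGdiff, -, hGfd⟩ := helper_endHolomorphic S p J ε' hε' hball hJstd G hGs hGJ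
  have hfdiff : DifferentiableOn ℂ (fun ξ : ℂ => (Ycoord p (G ξ)).1) {ξ : ℂ | 2 * R < ‖ξ‖} :=
    (hGdiff.mono (s := {ξ : ℂ | 2 * R < ‖ξ‖}) fun ξ hξ => hGfar ξ hξ).fst
  -- (1c) locally uniform convergence of the first flat coordinates on `V`
  have hlim : TendstoLocallyUniformlyOn (fun (k : ℕ) (ξ : ℂ) => (Ycoord p (u (φ k) ξ)).1)
      (fun ξ : ℂ => (Ycoord p (G ξ)).1) atTop {ξ : ℂ | 2 * R < ‖ξ‖} :=
    uniformContinuous_fst.comp_tendstoLocallyUniformlyOn hconvY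
  -- (2) Hurwitz (univalence): `φ⋆` is injective on `V` (constancy is excluded by the decay bound)
  have hfinj : InjOn (fun ξ : ℂ => (Ycoord p (G ξ)).1) {ξ : ℂ | 2 * R < ‖ξ‖} := by
    rcases helper_hurwitzInjective _ hVopen hVpre _ _ hFdiff hFinj hlim with ⟨c, hc⟩ | h
    · exact (limitHoloFar_not_const hRpos hdecay hc).elim
    · exact h
  -- (3) Hurwitz (zeros) for the derivatives: `φ⋆' ≠ 0` on `V`
  have hfder : ∀ ξ ∈ {ξ : ℂ | 2 * R < ‖ξ‖}, deriv (fun ξ : ℂ => (Ycoord p (G ξ)).1) ξ ≠ 0 := by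
    have hlim' : TendstoLocallyUniformlyOn
        (fun k : ℕ => deriv (fun ξ : ℂ => (Ycoord p (u (φ k) ξ)).1))
        (deriv fun ξ : ℂ => (Ycoord p (G ξ)).1) atTop {ξ : ℂ | 2 * R < ‖ξ‖} :=
      hlim.deriv (Eventually.of_forall hFdiff) hVopen
    rcases helper_hurwitz _ hVopen hVpre
        (fun k : ℕ => deriv (fun ξ : ℂ => (Ycoord p (u (φ k) ξ)).1))
        (deriv fun ξ : ℂ => (Ycoord p (G ξ)).1)
        (fun k => (hFdiff k).deriv hVopen) hFder hlim' with h0 | h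
    · exfalso
      obtain ⟨c, hc⟩ :=
        hVopen.exists_is_const_of_deriv_eq_zero hVpre hfdiff fun ξ hξ => h0 ξ hξ
      exact limitHoloFar_not_const hRpos hdecay hc
    · exact h
  -- (4) conclusions: injectivity of `G` and of `dG(ξ)` on `V`
  refine ⟨fun ξ hξ ξ' hξ' hG => hfinj hξ hξ' ?_, fun ξ hξ => ?_⟩
  · show (Ycoord p (G ξ)).1 = (Ycoord p (G ξ')).1
    rw [hG]
  · have hx : InPuncturedChartBall p ε' (G ξ) := hGfar ξ hξ
    have hfC : DifferentiableAt ℂ (fun ξ : ℂ => (Ycoord p (G ξ)).1) ξ :=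
      hfdiff.differentiableAt (hVopen.mem_nhds hξ)
    have hYR : DifferentiableAt ℝ (fun ξ : ℂ => Ycoord p (G ξ)) ξ :=
      differentiableAt_real_Ycoord_comp hGs hx
    intro ζ ζ' h
    have h1 := fst_fderiv_eq_deriv_mul hYR hfC ζ
    have h2 := fst_fderiv_eq_deriv_mul hYR hfC ζ'
    rw [hGfd ξ hx ζ, h, ← hGfd ξ hx ζ', h2] at h1
    -- `ζ ζ' : TangentSpace 𝓘(ℝ, ℂ) ξ`, definitionally `ℂ`: cancel `φ⋆'(ξ) ≠ 0` in `ℂ`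
    have h3 : @Eq ℂ ζ ζ' := mul_left_cancel₀ (M₀ := ℂ) (hfder ξ hξ) h1.symm
    exact h3

end Summit.SmoothPoincare4.SmoothPoincare4.Theorems.WitnessCharge.PencilIncompleteness
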